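import Literature.Analysis.FluidPDE.TorusNSGevreyBalance
import Literature.Analysis.FunctionSpaces.TorusGevreySobolevBounds
import HarnessLib

/-!
# Lattice form of the Gevrey balance for the linearised Navier–Stokes equation on `T^d`

Analysis/FluidPDE support file (theorems only; no definitions, no named facts), first of three
files (`TorusLinearisedNSGevreyLattice`, `…Balance`, `…Smoothing`) proving the **Gevrey-class
smoothing of the LINEARISED Navier–Stokes flow along a uniformly Gevrey background** on `T^d` — the
linear twin of the Foias–Temam estimate for classical solutions (J. Funct. Anal. 87 (1989),
Thm 1.1 / Lemma 2.1) proved in `TorusNSGevrey{Lattice,Coefficients,Sums,Balance,Bootstrap}`, whose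
lattice layer is reused by import: the truncated weights `e_k = exp(ψ min(|k|, N))` and their
submultiplicativity `NSGevrey.exp_mul_min_le_mul`, the trilinear lattice inequality
`NSGevrey.sum_mul_tsum_mul_le`, the absorbed weight derivative
`NSGevrey.two_mul_min_mul_freqNormSq_le` and Young `NSGevrey.two_mul_le_quarter_add`.

With `x_k = |k|²`, a nonnegative family `a` (the sizes `‖ŵ(k)‖` of the modes of the mean-zero
perturbation, `a 0 = 0`), a nonnegative family `g` (the sizes `‖û(m)‖` of the modes of the
background), `Y_R = ∑_{ball R} e² x a²`, `Z_R = ∑_{ball R} e² x² a²` and the full sum `Y`: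

* `NSGevrey.linearisedLatticeBalance_le` — the **pure lattice inequality**: if `|r_k| ≤ b_k a_k` with
  the two BILINEAR convolution bounds `b_k ≤ C ∑ₘ gₘ |k−m| a_{k−m} + C ∑ₘ aₘ |k−m| g_{k−m}`
  (`𝓕((u·∇)w)`, `𝓕((w·∇)u)`, `NSGevrey.norm_mFourierCoeff_convect_le`) and the background obeys
  `∑ₘ e^{σ|m|} (1 + |m|) gₘ ≤ A` (`ψ ≤ σ`), then
  `∑_{ball R} (2 min(|k|,N) e² x a² + e² x · 2(−κ x a² − r)) ≤ −(5/4)κ Z_R + (2 + 16 C² A²)/κ · Y`,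
  LINEAR in `Y`: each bilinear term is `≤ C A √Y √Z_R` once `e_k ≤ e_m e_{k−m}` has distributed the
  weight (in `(u·∇)w` the derivative falls on `w`, in `(w·∇)u` on the background — reindex
  `m ↦ k − m`), so that, unlike the quadratic case (`NSGevrey.exists_latticeBalance_bound`), no `ℓ¹`
  splitting, no bootstrap level and no restriction on `card d` are needed;
* `NSGevrey.summable_exp_mul_one_add_sqrt_mul_norm_of_gevreyBound` — a Gevrey bound
  `∑_{k ∈ S} e^{2σ₀|k|} ‖c k‖² ≤ C₀` (all finite `S`) gives the weighted `ℓ¹` bound of the background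
  at half the radius: `∑ₘ e^{(σ₀/2)|m|} (1 + |m|) ‖c m‖ ≤ 2 √C₀ ∑ₘ (1 + |m|²) e^{−(σ₀/2)|m|}`
  (`Torus.norm_le_sqrt_mul_exp_neg_of_gevreyBound`, `Torus.summable_one_add_freqNormSq_pow_mul_exp_neg`).

Tree search (`lean search 'linearised.*[Gg]evrey|Gevrey.*[Ll]inearis|LatticeBalance'`): only the
quadratic balance, hard-wired to `∑ₘ aₘ |k−m| a_{k−m}`.

Reference: C. Foias, R. Temam, *Gevrey class regularity for the solutions of the Navier–Stokes
equations*, J. Funct. Anal. 87 (1989) 359–369, Thm 1.1, Lemma 2.1, (2.7)–(2.15) (stated for the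
nonlinear system; the linearisation obeys the same estimates with one factor frozen). [FoiasTemam1989]
-/

noncomputable section

open MeasureTheory Set Filter UnitAddTorus Function Finset
open scoped Topology BigOperators InnerProductSpace

namespace Literature.Analysis.FluidPDE

namespace NSGevrey

open Literature.Analysis.FunctionSpaces Literature.Analysis.FunctionSpaces.Torus

variable {d : Type*} [Fintype d] [DecidableEq d]

/-! ### The lattice form of the linearised Gevrey balance -/

section Lattice

/-- **The linearised Foias–Temam Gevrey balance on the lattice** (truncated weights
`e_k = exp(ψ min(|k|,N))`, `0 ≤ ψ ≤ σ`, `N ≥ 0`, one inequality at a fixed time). Let `κ > 0`,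
`C ≥ 0`, `a ≥ 0` with `a 0 = 0` and `∑ |k|⁴ a_k² < ∞` (the perturbation), `g ≥ 0` with
`∑ₘ e^{σ|m|}(1 + |m|) gₘ ≤ A` (the Gevrey background), `|r_k| ≤ b_k a_k` with the bilinear
convolution bounds `b_k ≤ C ∑ₘ gₘ |k−m| a_{k−m} + C ∑ₘ aₘ |k−m| g_{k−m}`. Then
`∑_{k ∈ ball R} (2 min(|k|,N) e_k²|k|²a_k² + e_k²|k|² · 2(−κ|k|²a_k² − r_k))`
`≤ −(5/4)κ ∑_{ball R} e_k²|k|⁴a_k² + (2 + 16 C² A²)/κ · ∑ₖ e_k²|k|²a_k²`: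
the weight derivative `2|k||k|² ≤ (κ/2)|k|⁴ + (2/κ)|k|²`, and each bilinear term is
`≤ C A √Y √Z_R` by `e_k ≤ e_m e_{k−m}` and the trilinear lattice inequality, then Young.
[cite: FoiasTemam1989, Lemma 2.1 and (2.7)–(2.15)] -/
theorem linearisedLatticeBalance_le {κ C A : ℝ} (hκ : 0 < κ) (hC : 0 ≤ C)
    {a g b r : (d → ℤ) → ℝ} {ψ σ N : ℝ} (R : ℕ)
    (ha0 : ∀ k, 0 ≤ a k) (ha00 : a 0 = 0) (hZs : Summable fun k => freqNormSq k ^ 2 * a k ^ 2)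
    (hg0 : ∀ k, 0 ≤ g k)
    (hgs : Summable fun m => Real.exp (σ * Real.sqrt (freqNormSq m)) *
      ((1 + Real.sqrt (freqNormSq m)) * g m))
    (hgA : ∑' m, Real.exp (σ * Real.sqrt (freqNormSq m)) * ((1 + Real.sqrt (freqNormSq m)) * g m) ≤ A)
    (hψ : 0 ≤ ψ) (hψσ : ψ ≤ σ) (hN : 0 ≤ N)
    (hb : ∀ k, b k ≤ C * ∑' m, g m * (Real.sqrt (freqNormSq (k - m)) * a (k - m)) +
      C * ∑' m, a m * (Real.sqrt (freqNormSq (k - m)) * g (k - m)))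
    (hr : ∀ k, |r k| ≤ b k * a k) :
    ∑ k ∈ freqBall R, (2 * min (Real.sqrt (freqNormSq k)) N *
          Real.exp (ψ * min (Real.sqrt (freqNormSq k)) N) ^ 2 * (freqNormSq k * a k ^ 2) +
        Real.exp (ψ * min (Real.sqrt (freqNormSq k)) N) ^ 2 *
          (freqNormSq k * (2 * (-(κ * freqNormSq k) * a k ^ 2 - r k)))) ≤
      -(5 / 4 * κ) * ∑ k ∈ freqBall R, Real.exp (ψ * min (Real.sqrt (freqNormSq k)) N) ^ 2 *
          (freqNormSq k ^ 2 * a k ^ 2) +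
        (2 + 16 * C ^ 2 * A ^ 2) / κ * ∑' k, Real.exp (ψ * min (Real.sqrt (freqNormSq k)) N) ^ 2 *
          (freqNormSq k * a k ^ 2) := by
  -- adapted from `NSGevrey.exists_latticeBalance_bound` (`TorusNSGevreyBalance`): the weights
  set e : (d → ℤ) → ℝ := fun k => Real.exp (ψ * min (Real.sqrt (freqNormSq k)) N) with he
  have he0 : ∀ k, 0 < e k := fun k => Real.exp_pos _
  set W : ℝ := Real.exp (ψ * N) ^ 2 with hW
  have heW : ∀ k, e k ^ 2 ≤ W := fun k =>
    pow_le_pow_left₀ (he0 k).le (exp_mul_min_le_exp_mul hψ k) 2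
  have hsub : ∀ k m, e k ≤ e m * e (k - m) := fun k m => exp_mul_min_le_mul hψ hN k m
  have heσ : ∀ k, e k ≤ Real.exp (σ * Real.sqrt (freqNormSq k)) := fun k =>
    (exp_mul_min_le_exp_mul_sqrt hψ k).trans
      (Real.exp_le_exp.2 (mul_le_mul_of_nonneg_right hψσ (Real.sqrt_nonneg _)))
  -- summability of the weighted moments
  have hx0 : ∀ k : d → ℤ, 0 ≤ freqNormSq k := fun k => freqNormSq_nonneg k
  have hZw : Summable fun k => e k ^ 2 * (freqNormSq k ^ 2 * a k ^ 2) :=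
    (hZs.mul_left W).of_nonneg_of_le (fun k => by positivity) fun k =>
      mul_le_mul_of_nonneg_right (heW k) (by positivity)
  have hYw : Summable fun k => e k ^ 2 * (freqNormSq k * a k ^ 2) :=
    hZw.of_nonneg_of_le (fun k => mul_nonneg (sq_nonneg _) (mul_nonneg (hx0 k) (sq_nonneg _))) fun k =>
      mul_le_mul_of_nonneg_left (mul_le_mul_of_nonneg_right (freqNormSq_le_freqNormSq_sq k) (sq_nonneg _))
        (sq_nonneg _)
  set Y : ℝ := ∑' k, e k ^ 2 * (freqNormSq k * a k ^ 2) with hY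
  set YR : ℝ := ∑ k ∈ freqBall R, e k ^ 2 * (freqNormSq k * a k ^ 2) with hYR
  set ZR : ℝ := ∑ k ∈ freqBall R, e k ^ 2 * (freqNormSq k ^ 2 * a k ^ 2) with hZR
  have hy0 : ∀ k, 0 ≤ e k ^ 2 * (freqNormSq k * a k ^ 2) := fun k =>
    mul_nonneg (sq_nonneg _) (mul_nonneg (hx0 k) (sq_nonneg _))
  have hY0 : 0 ≤ Y := tsum_nonneg hy0
  have hZR0 : 0 ≤ ZR := Finset.sum_nonneg fun k _ => by positivity
  have hYRY : YR ≤ Y := sum_freqBall_le_tsum hy0 hYw R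
  -- the auxiliary families: `α, α'` (background), `β, β'` (perturbation), `γ`
  set α : (d → ℤ) → ℝ := fun m => e m * g m with hα
  set α' : (d → ℤ) → ℝ := fun m => e m * (Real.sqrt (freqNormSq m) * g m) with hα'
  set β : (d → ℤ) → ℝ := fun k => e k * (Real.sqrt (freqNormSq k) * a k) with hβ
  set β' : (d → ℤ) → ℝ := fun k => e k * a k with hβ'
  set γ : (d → ℤ) → ℝ := fun k => freqNormSq k * (e k * a k) with hγ
  have hα0 : ∀ k, 0 ≤ α k := fun k => mul_nonneg (he0 k).le (hg0 k)
  have hα'0 : ∀ k, 0 ≤ α' k := fun k => mul_nonneg (he0 k).le (mul_nonneg (Real.sqrt_nonneg _) (hg0 k))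
  have hβ0 : ∀ k, 0 ≤ β k := fun k => mul_nonneg (he0 k).le (mul_nonneg (Real.sqrt_nonneg _) (ha0 k))
  have hβ'0 : ∀ k, 0 ≤ β' k := fun k => mul_nonneg (he0 k).le (ha0 k)
  have hγ0 : ∀ k, 0 ≤ γ k := fun k => mul_nonneg (hx0 k) (hβ'0 k)
  have hβ2 : ∀ k, β k ^ 2 = e k ^ 2 * (freqNormSq k * a k ^ 2) := fun k => by
    simp only [hβ, mul_pow, Real.sq_sqrt (hx0 k)]
  have hγ2 : ∀ k, γ k ^ 2 = e k ^ 2 * (freqNormSq k ^ 2 * a k ^ 2) := fun k => by simp only [hγ]; ring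
  have hβs : Summable fun k => β k ^ 2 := hYw.congr fun k => (hβ2 k).symm
  have hβY : ∑' k, β k ^ 2 = Y := tsum_congr hβ2
  -- `β'² ≤ β²` (`a 0 = 0` and `|k| ≥ 1` off the origin), so `∑ β'² ≤ Y`
  have hβ'β : ∀ k, β' k ^ 2 ≤ β k ^ 2 := by
    intro k
    by_cases hk : k = 0
    · simp only [hβ', hβ, hk, ha00, mul_zero]
      exact le_rfl
    · rw [hβ2, hβ', mul_pow]
      exact mul_le_mul_of_nonneg_left (le_mul_of_one_le_left (sq_nonneg _) (one_le_freqNormSq_of_ne_zero hk))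
        (sq_nonneg _)
  have hβ's : Summable fun k => β' k ^ 2 := hβs.of_nonneg_of_le (fun k => sq_nonneg _) hβ'β
  have hβ'Y : ∑' k, β' k ^ 2 ≤ Y := hβY ▸ hβ's.tsum_le_tsum hβ'β hβs
  -- the background: `∑ α ≤ A`, `∑ α' ≤ A`
  have hαG : ∀ m, α m ≤ Real.exp (σ * Real.sqrt (freqNormSq m)) * ((1 + Real.sqrt (freqNormSq m)) * g m) :=
    fun m => mul_le_mul (heσ m) (le_mul_of_one_le_left (hg0 m) (le_add_of_nonneg_right (Real.sqrt_nonneg _)))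
      (hg0 m) (Real.exp_pos _).le
  have hα'G : ∀ m, α' m ≤ Real.exp (σ * Real.sqrt (freqNormSq m)) * ((1 + Real.sqrt (freqNormSq m)) * g m) :=
    fun m => mul_le_mul (heσ m) (mul_le_mul_of_nonneg_right (le_add_of_nonneg_left zero_le_one) (hg0 m))
      (mul_nonneg (Real.sqrt_nonneg _) (hg0 m)) (Real.exp_pos _).le
  have hαs : Summable α := hgs.of_nonneg_of_le hα0 hαG
  have hα's : Summable α' := hgs.of_nonneg_of_le hα'0 hα'G
  have hαA : ∑' m, α m ≤ A := (hαs.tsum_le_tsum hαG hgs).trans hgA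
  have hα'A : ∑' m, α' m ≤ A := (hα's.tsum_le_tsum hα'G hgs).trans hgA
  have hA0 : 0 ≤ A := (tsum_nonneg hα0).trans hαA
  -- the two convolution bounds with the weights distributed
  have hβle : ∀ k, β k ≤ Real.sqrt Y := fun k => hβY ▸ le_sqrt_tsum_sq hβ0 hβs k
  have hβ'le : ∀ k, β' k ≤ Real.sqrt Y := fun k =>
    (le_sqrt_tsum_sq hβ'0 hβ's k).trans (Real.sqrt_le_sqrt hβ'Y)
  have hαβs : ∀ k, Summable fun m => α m * β (k - m) := fun k =>
    (hαs.mul_right (Real.sqrt Y)).of_nonneg_of_le (fun m => mul_nonneg (hα0 m) (hβ0 _)) fun m =>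
      mul_le_mul_of_nonneg_left (hβle _) (hα0 m)
  have hα'β's : ∀ k, Summable fun m => α' m * β' (k - m) := fun k =>
    (hα's.mul_right (Real.sqrt Y)).of_nonneg_of_le (fun m => mul_nonneg (hα'0 m) (hβ'0 _)) fun m =>
      mul_le_mul_of_nonneg_left (hβ'le _) (hα'0 m)
  have hconv1 : ∀ k, e k * (C * ∑' m, g m * (Real.sqrt (freqNormSq (k - m)) * a (k - m))) ≤
      C * ∑' m, α m * β (k - m) := by
    intro k
    have hterm : ∀ m, e k * (g m * (Real.sqrt (freqNormSq (k - m)) * a (k - m))) ≤ α m * β (k - m) := by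
      intro m
      have hq : 0 ≤ g m * (Real.sqrt (freqNormSq (k - m)) * a (k - m)) :=
        mul_nonneg (hg0 m) (mul_nonneg (Real.sqrt_nonneg _) (ha0 _))
      calc e k * (g m * (Real.sqrt (freqNormSq (k - m)) * a (k - m)))
          ≤ (e m * e (k - m)) * (g m * (Real.sqrt (freqNormSq (k - m)) * a (k - m))) :=
            mul_le_mul_of_nonneg_right (hsub k m) hq
        _ = α m * β (k - m) := by simp only [hα, hβ]; ring
    have hs1 : Summable fun m => e k * (g m * (Real.sqrt (freqNormSq (k - m)) * a (k - m))) :=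
      (hαβs k).of_nonneg_of_le (fun m => mul_nonneg (he0 k).le (mul_nonneg (hg0 m)
        (mul_nonneg (Real.sqrt_nonneg _) (ha0 _)))) hterm
    rw [mul_left_comm, ← tsum_mul_left]
    exact mul_le_mul_of_nonneg_left (hs1.tsum_le_tsum hterm (hαβs k)) hC
  have hconv2 : ∀ k, e k * (C * ∑' m, a m * (Real.sqrt (freqNormSq (k - m)) * g (k - m))) ≤
      C * ∑' m, α' m * β' (k - m) := by
    intro k
    -- reindex `m ↦ k - m`: the derivative sits on the background
    have hre : ∑' m, a m * (Real.sqrt (freqNormSq (k - m)) * g (k - m)) =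
        ∑' j, a (k - j) * (Real.sqrt (freqNormSq j) * g j) := by
      rw [← (Equiv.subLeft k).tsum_eq fun m => a m * (Real.sqrt (freqNormSq (k - m)) * g (k - m))]
      exact tsum_congr fun j => by simp only [Equiv.subLeft_apply, sub_sub_cancel]
    rw [hre]
    have hterm : ∀ j, e k * (a (k - j) * (Real.sqrt (freqNormSq j) * g j)) ≤ α' j * β' (k - j) := by
      intro j
      have hq : 0 ≤ a (k - j) * (Real.sqrt (freqNormSq j) * g j) :=
        mul_nonneg (ha0 _) (mul_nonneg (Real.sqrt_nonneg _) (hg0 j))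
      calc e k * (a (k - j) * (Real.sqrt (freqNormSq j) * g j))
          ≤ (e j * e (k - j)) * (a (k - j) * (Real.sqrt (freqNormSq j) * g j)) :=
            mul_le_mul_of_nonneg_right (hsub k j) hq
        _ = α' j * β' (k - j) := by simp only [hα', hβ']; ring
    have hs2 : Summable fun j => e k * (a (k - j) * (Real.sqrt (freqNormSq j) * g j)) :=
      (hα'β's k).of_nonneg_of_le (fun j => mul_nonneg (he0 k).le (mul_nonneg (ha0 _)
        (mul_nonneg (Real.sqrt_nonneg _) (hg0 j)))) hterm
    rw [mul_left_comm, ← tsum_mul_left]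
    exact mul_le_mul_of_nonneg_left (hs2.tsum_le_tsum hterm (hα'β's k)) hC
  -- termwise bounds
  have h1 : ∀ k, 2 * min (Real.sqrt (freqNormSq k)) N * e k ^ 2 * (freqNormSq k * a k ^ 2) ≤
      κ / 2 * (e k ^ 2 * (freqNormSq k ^ 2 * a k ^ 2)) + 2 / κ * (e k ^ 2 * (freqNormSq k * a k ^ 2)) := by
    intro k
    have h := two_mul_min_mul_freqNormSq_le hκ N k
    have hw : 0 ≤ e k ^ 2 * a k ^ 2 := by positivity
    calc 2 * min (Real.sqrt (freqNormSq k)) N * e k ^ 2 * (freqNormSq k * a k ^ 2)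
        = (2 * min (Real.sqrt (freqNormSq k)) N * freqNormSq k) * (e k ^ 2 * a k ^ 2) := by ring
      _ ≤ (κ / 2 * freqNormSq k ^ 2 + 2 / κ * freqNormSq k) * (e k ^ 2 * a k ^ 2) :=
          mul_le_mul_of_nonneg_right h hw
      _ = _ := by ring
  have h3 : ∀ k, e k ^ 2 * (freqNormSq k * (2 * -r k)) ≤
      2 * C * (γ k * ∑' m, α m * β (k - m)) + 2 * C * (γ k * ∑' m, α' m * β' (k - m)) := by
    intro k
    have hrk : -r k ≤ b k * a k := (neg_le_abs (r k)).trans (hr k)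
    have hba : b k * a k ≤ (C * ∑' m, g m * (Real.sqrt (freqNormSq (k - m)) * a (k - m)) +
        C * ∑' m, a m * (Real.sqrt (freqNormSq (k - m)) * g (k - m))) * a k :=
      mul_le_mul_of_nonneg_right (hb k) (ha0 k)
    have hw : 0 ≤ e k ^ 2 * freqNormSq k * 2 := mul_nonneg (mul_nonneg (sq_nonneg _) (hx0 k)) (by norm_num)
    calc e k ^ 2 * (freqNormSq k * (2 * -r k)) = (e k ^ 2 * freqNormSq k * 2) * (-r k) := by ring
      _ ≤ (e k ^ 2 * freqNormSq k * 2) * ((C * ∑' m, g m * (Real.sqrt (freqNormSq (k - m)) * a (k - m)) +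
          C * ∑' m, a m * (Real.sqrt (freqNormSq (k - m)) * g (k - m))) * a k) :=
          mul_le_mul_of_nonneg_left (hrk.trans hba) hw
      _ = 2 * (γ k * (e k * (C * ∑' m, g m * (Real.sqrt (freqNormSq (k - m)) * a (k - m))))) +
          2 * (γ k * (e k * (C * ∑' m, a m * (Real.sqrt (freqNormSq (k - m)) * g (k - m))))) := by
          simp only [hγ]; ring
      _ ≤ 2 * (γ k * (C * ∑' m, α m * β (k - m))) + 2 * (γ k * (C * ∑' m, α' m * β' (k - m))) :=
          add_le_add (mul_le_mul_of_nonneg_left (mul_le_mul_of_nonneg_left (hconv1 k) (hγ0 k)) (by norm_num))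
            (mul_le_mul_of_nonneg_left (mul_le_mul_of_nonneg_left (hconv2 k) (hγ0 k)) (by norm_num))
      _ = _ := by ring
  -- the two trilinear sums and Young
  have hγZR : ∑ k ∈ freqBall R, γ k ^ 2 = ZR := Finset.sum_congr rfl fun k _ => hγ2 k
  have htri1 : ∑ k ∈ freqBall R, γ k * ∑' m, α m * β (k - m) ≤ A * Real.sqrt Y * Real.sqrt ZR := by
    have hcore := sum_mul_tsum_mul_le (freqBall R) hα0 hβ0 hγ0 hαs hβs
    rw [hβY, hγZR] at hcore
    exact hcore.trans (mul_le_mul_of_nonneg_right (mul_le_mul_of_nonneg_right hαA (Real.sqrt_nonneg _))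
      (Real.sqrt_nonneg _))
  have htri2 : ∑ k ∈ freqBall R, γ k * ∑' m, α' m * β' (k - m) ≤ A * Real.sqrt Y * Real.sqrt ZR := by
    have hcore := sum_mul_tsum_mul_le (freqBall R) hα'0 hβ'0 hγ0 hα's hβ's
    rw [hγZR] at hcore
    exact hcore.trans (mul_le_mul_of_nonneg_right (mul_le_mul hα'A (Real.sqrt_le_sqrt hβ'Y)
      (Real.sqrt_nonneg _) hA0) (Real.sqrt_nonneg _))
  have htri : ∑ k ∈ freqBall R, (2 * C * (γ k * ∑' m, α m * β (k - m)) +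
      2 * C * (γ k * ∑' m, α' m * β' (k - m))) ≤ κ / 4 * ZR + 16 * C ^ 2 * A ^ 2 / κ * Y := by
    rw [Finset.sum_add_distrib, ← Finset.mul_sum, ← Finset.mul_sum]
    have h2C : 0 ≤ 2 * C := by positivity
    have hsq : (2 * C * A * Real.sqrt Y) ^ 2 = 4 * C ^ 2 * A ^ 2 * Y := by
      rw [mul_pow, Real.sq_sqrt hY0]; ring
    have hyoung := two_mul_le_quarter_add hκ (2 * C * A * Real.sqrt Y) (Real.sqrt ZR)
    rw [Real.sq_sqrt hZR0, hsq] at hyoung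
    calc 2 * C * ∑ k ∈ freqBall R, γ k * ∑' m, α m * β (k - m) +
          2 * C * ∑ k ∈ freqBall R, γ k * ∑' m, α' m * β' (k - m)
        ≤ 2 * C * (A * Real.sqrt Y * Real.sqrt ZR) + 2 * C * (A * Real.sqrt Y * Real.sqrt ZR) :=
          add_le_add (mul_le_mul_of_nonneg_left htri1 h2C) (mul_le_mul_of_nonneg_left htri2 h2C)
      _ = 2 * (2 * C * A * Real.sqrt Y) * Real.sqrt ZR := by ring
      _ ≤ κ / 4 * ZR + 4 / κ * (4 * C ^ 2 * A ^ 2 * Y) := hyoung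
      _ = κ / 4 * ZR + 16 * C ^ 2 * A ^ 2 / κ * Y := by ring
  -- assemble
  have hsplit3 : ∀ k, 2 * min (Real.sqrt (freqNormSq k)) N * e k ^ 2 * (freqNormSq k * a k ^ 2) +
      e k ^ 2 * (freqNormSq k * (2 * (-(κ * freqNormSq k) * a k ^ 2 - r k))) =
      2 * min (Real.sqrt (freqNormSq k)) N * e k ^ 2 * (freqNormSq k * a k ^ 2) +
        (-(2 * κ) * (e k ^ 2 * (freqNormSq k ^ 2 * a k ^ 2))) +
        e k ^ 2 * (freqNormSq k * (2 * -r k)) := fun k => by ring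
  rw [Finset.sum_congr rfl fun k _ => hsplit3 k, Finset.sum_add_distrib, Finset.sum_add_distrib]
  have hS1 : ∑ k ∈ freqBall R, 2 * min (Real.sqrt (freqNormSq k)) N * e k ^ 2 * (freqNormSq k * a k ^ 2) ≤
      κ / 2 * ZR + 2 / κ * YR := by
    rw [hZR, hYR, Finset.mul_sum, Finset.mul_sum, ← Finset.sum_add_distrib]
    exact Finset.sum_le_sum fun k _ => h1 k
  have hS2 : ∑ k ∈ freqBall R, -(2 * κ) * (e k ^ 2 * (freqNormSq k ^ 2 * a k ^ 2)) = -(2 * κ) * ZR := by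
    rw [hZR, Finset.mul_sum]
  have hS3 : ∑ k ∈ freqBall R, e k ^ 2 * (freqNormSq k * (2 * -r k)) ≤
      κ / 4 * ZR + 16 * C ^ 2 * A ^ 2 / κ * Y :=
    (Finset.sum_le_sum fun k _ => h3 k).trans htri
  have hκY : 2 / κ * YR ≤ 2 / κ * Y := mul_le_mul_of_nonneg_left hYRY (by positivity)
  have hK : (2 + 16 * C ^ 2 * A ^ 2) / κ * Y = 2 / κ * Y + 16 * C ^ 2 * A ^ 2 / κ * Y := by ring
  rw [hS2, hK]
  linarith [hS1, hS3, hκY]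

end Lattice

/-! ### The weighted `ℓ¹` bound of a Gevrey background -/

section Background

omit [DecidableEq d] in
/-- **A Gevrey bound gives the weighted `ℓ¹` bound of the background at half the radius**: if
`∑_{k ∈ S} e^{2σ₀|k|} ‖c k‖² ≤ C₀` for all finite `S ⊆ ℤ^d` (`σ₀ > 0`), then
`m ↦ e^{(σ₀/2)|m|} (1 + |m|) ‖c m‖` is summable with sum at most
`2 √C₀ ∑ₘ (1 + |m|²) e^{−(σ₀/2)|m|}` (modewise `‖c m‖ ≤ √C₀ e^{−σ₀|m|}` and `1 + |m| ≤ 2(1 + |m|²)`).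
This is the form in which the background enters `NSGevrey.linearisedLatticeBalance_le`. [folklore] -/
theorem summable_exp_mul_one_add_sqrt_mul_norm_of_gevreyBound {V : Type*} [NormedAddCommGroup V]
    {σ₀ C₀ : ℝ} {c : (d → ℤ) → V} (hσ₀ : 0 < σ₀)
    (h : ∀ S : Finset (d → ℤ), ∑ k ∈ S, Real.exp (2 * σ₀ * Real.sqrt (freqNormSq k)) * ‖c k‖ ^ 2 ≤ C₀) :
    (Summable fun m : d → ℤ => Real.exp (σ₀ / 2 * Real.sqrt (freqNormSq m)) *
        ((1 + Real.sqrt (freqNormSq m)) * ‖c m‖)) ∧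
      ∑' m : d → ℤ, Real.exp (σ₀ / 2 * Real.sqrt (freqNormSq m)) *
          ((1 + Real.sqrt (freqNormSq m)) * ‖c m‖) ≤
        2 * Real.sqrt C₀ * ∑' m : d → ℤ, (1 + freqNormSq m) ^ 1 *
          Real.exp (-(σ₀ / 2 * Real.sqrt (freqNormSq m))) := by
  have hmaj := (summable_one_add_freqNormSq_pow_mul_exp_neg (d := d) (half_pos hσ₀) 1).mul_left
    (2 * Real.sqrt C₀)
  have hle : ∀ m : d → ℤ, Real.exp (σ₀ / 2 * Real.sqrt (freqNormSq m)) *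
      ((1 + Real.sqrt (freqNormSq m)) * ‖c m‖) ≤
      2 * Real.sqrt C₀ * ((1 + freqNormSq m) ^ 1 * Real.exp (-(σ₀ / 2 * Real.sqrt (freqNormSq m)))) := by
    intro m
    have hc : ‖c m‖ ≤ Real.sqrt C₀ * Real.exp (-(σ₀ * Real.sqrt (freqNormSq m))) :=
      norm_le_sqrt_mul_exp_neg_of_gevreyBound h m
    have hss : Real.sqrt (freqNormSq m) ^ 2 = freqNormSq m := Real.sq_sqrt (freqNormSq_nonneg m)
    have h1s : 1 + Real.sqrt (freqNormSq m) ≤ 2 * (1 + freqNormSq m) ^ 1 := by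
      rw [pow_one]
      nlinarith [hss, sq_nonneg (Real.sqrt (freqNormSq m) - 1 / 4)]
    have hexp : Real.exp (σ₀ / 2 * Real.sqrt (freqNormSq m)) * Real.exp (-(σ₀ * Real.sqrt (freqNormSq m))) =
        Real.exp (-(σ₀ / 2 * Real.sqrt (freqNormSq m))) := by
      rw [← Real.exp_add]
      congr 1
      ring
    have h2 : 0 ≤ 2 * (1 + freqNormSq m) ^ 1 := mul_nonneg zero_le_two (one_add_freqNormSq_pow_nonneg m 1)
    calc Real.exp (σ₀ / 2 * Real.sqrt (freqNormSq m)) * ((1 + Real.sqrt (freqNormSq m)) * ‖c m‖)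
        ≤ Real.exp (σ₀ / 2 * Real.sqrt (freqNormSq m)) * ((2 * (1 + freqNormSq m) ^ 1) *
            (Real.sqrt C₀ * Real.exp (-(σ₀ * Real.sqrt (freqNormSq m))))) :=
          mul_le_mul_of_nonneg_left (mul_le_mul h1s hc (norm_nonneg _) h2) (Real.exp_pos _).le
      _ = 2 * Real.sqrt C₀ * ((1 + freqNormSq m) ^ 1 * (Real.exp (σ₀ / 2 * Real.sqrt (freqNormSq m)) *
            Real.exp (-(σ₀ * Real.sqrt (freqNormSq m))))) := by ring
      _ = _ := by rw [hexp]
  have h0 : ∀ m : d → ℤ, 0 ≤ Real.exp (σ₀ / 2 * Real.sqrt (freqNormSq m)) *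
      ((1 + Real.sqrt (freqNormSq m)) * ‖c m‖) := fun m =>
    mul_nonneg (Real.exp_pos _).le (mul_nonneg (add_nonneg zero_le_one (Real.sqrt_nonneg _)) (norm_nonneg _))
  have hs := hmaj.of_nonneg_of_le h0 hle
  refine ⟨hs, (hs.tsum_le_tsum hle hmaj).trans (le_of_eq ?_)⟩
  exact tsum_mul_left

end Background

end NSGevrey

end Literature.Analysis.FluidPDE
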